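import Summits.QuantumFields.YangMills.Theorems.PoincareLipschitzBlowDownCells
import Summits.QuantumFields.YangMills.Theorems.PoincareLipschitzLatticeTranslationPaths
import Summits.QuantumFields.YangMills.Theorems.PoincareLipschitzTwoGridCells
import Summits.QuantumFields.YangMills.Theorems.PoincareLipschitzTranslationModulus
import Summits.QuantumFields.YangMills.Theorems.PoincareLipschitzSamplingCells
import Mathlib.MeasureTheory.Function.LpSeminorm.Indicator
import HarnessLib

/-!
# LINE 25 «CompactnessTransfer» (crux `HistoryTailL` stmt-QuantumFields-19936 ∕ K2 crux `BlockLipschitzL` stmt-QuantumFields-23533), S2′ infrastructure (Γ1) —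
# FILE E1: PRELIMINARIES OF THE Γ1 KNIT — the cubes, the lattice cube `[−N, N−1]³` and its energy, ★ the `√(8Λ₀)` bound on the cell means of the rescaled discrete
# gradient, ★★ the uniform `L²`-translation modulus of the zero-extended blow-down in `eLpNorm` form (✓M2b fed with ✓M2a and ✓M1 BY NAME)

Cell `ym3-torus` (YM ladder rung R3 = continuum SU(2) Yang–Mills on the three-torus — a RUNG, NOT the Clay problem: not d = 4, not infinite volume, not a mass gap);
width seat `ym3-torus-px3` gen 7, the Γ1 seat (LEAD ym-ust-19936-w1 g9 GO 11:10:54Z; registered stub `stub_blowDownL2Compact` of LINE 25 v1.3 on 23533).  THEOREMS ONLY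
(def-free); `--supports` the K2 crux as a helper.  Nothing here proves Γ1, S1′, S2♭, the organ, `BlockLipschitzL`, `HistoryTailL` or any summit statement.
* §1 cubes: `measurableSet_halfOpenCube`, `openCube_subset_halfOpenCube`, `halfOpenCube_subset_closedCube`, `cell_subset_halfOpenCube`.
* §2 `floorVec_mem_latticeCube`, `latticeCube_energy_le`, `card_latticeCube`.
* §3 ★ `norm_setIntegral_gradBlowDown_le` (`‖∫_D N•δ_μ u(z + ⌊N x⌋)‖ ≤ √(8Λ₀)` for measurable `D ⊆ [−1,1)³`; ✓`PoincareLipschitzBlowDownCells.setIntegral_comp_floorVec_le_sum` +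
  discrete Cauchy–Schwarz).
* §4 `abs_coord_le_norm`, ★★ `eLpNorm_translate_blowDown_sub_le` (`eLpNorm (f(· − y) − f) 2 ≤ (ofReal ((288Λ₀ + 192)δ))^{1∕2}` for `‖y‖ ≤ δ ≤ 1`, uniform in the mesh).
[folklore] ([Adams1975] Thm 2.21; [AlicandroCicalese2008] §2; [Giaquinta1984] Ch. III §1)
-/

set_option autoImplicit false

noncomputable section

open scoped BigOperators ENNReal
open MeasureTheory Set Filter Topology

namespace Summit.QuantumFields.YangMills.Theorems.PoincareLipschitzBlowDownModulus

open Literature.MathematicalPhysics.QuantumFieldTheory.Balaban1983to89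
open B4Eq19LatticeOperators (Zd box unitVec mem_box)
open Summit.QuantumFields.YangMills.Theorems.PoincareLipschitzBlowDownCells
open Summit.QuantumFields.YangMills.Theorems.PoincareLipschitzLatticeTranslationPaths
open Summit.QuantumFields.YangMills.Theorems.PoincareLipschitzTwoGridCells
open Summit.QuantumFields.YangMills.Theorems.PoincareLipschitzTranslationModulus
open Summit.QuantumFields.YangMills.Theorems.PoincareLipschitzSamplingCells (isCompact_absCubeClosed isOpen_absCube)

/-! ## §1 The cubes -/

/-- The half-open cube `[−1,1)³` is measurable. [folklore] -/
theorem measurableSet_halfOpenCube : MeasurableSet {x : EuclideanSpace ℝ (Fin 3) | ∀ i, -1 ≤ x i ∧ x i < 1} := by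
  have : {x : EuclideanSpace ℝ (Fin 3) | ∀ i, -1 ≤ x i ∧ x i < 1} = ⋂ i : Fin 3, (fun x : EuclideanSpace ℝ (Fin 3) => x i) ⁻¹' Set.Ico (-1) 1 := by
    ext x; simp [Set.mem_Ico]
  rw [this]
  exact MeasurableSet.iInter fun i => measurableSet_Ico.preimage (measurable_coord i)

/-- The open cube lies in the half-open cube. [folklore] -/
theorem openCube_subset_halfOpenCube : {x : EuclideanSpace ℝ (Fin 3) | ∀ i : Fin 3, |x i| < 1} ⊆ {x | ∀ i, -1 ≤ x i ∧ x i < 1} := by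
  intro x hx i
  have := abs_lt.1 (hx i)
  exact ⟨this.1.le, this.2⟩

/-- The half-open cube lies in the closed cube. [folklore] -/
theorem halfOpenCube_subset_closedCube : {x : EuclideanSpace ℝ (Fin 3) | ∀ i, -1 ≤ x i ∧ x i < 1} ⊆ {x | ∀ i : Fin 3, |x i| ≤ 1} := by
  intro x hx i
  rw [abs_le]
  exact ⟨(hx i).1, (hx i).2.le⟩

/-- A dyadic cell `{⌊2^m x⌋ = y}` with `−2^m ≤ yᵢ < 2^m` lies in the half-open cube. [folklore] -/
theorem cell_subset_halfOpenCube (m : ℕ) {y : Zd 3} (hy : ∀ i, -(2 : ℤ) ^ m ≤ y i ∧ y i < (2 : ℤ) ^ m) :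
    {x : EuclideanSpace ℝ (Fin 3) | ∀ i, ⌊(2 : ℝ) ^ m * x i⌋ = y i} ⊆ {x | ∀ i, -1 ≤ x i ∧ x i < 1} := by
  intro x hx i
  have h2 : (0 : ℝ) < (2 : ℝ) ^ m := by positivity
  have hfl := hx i
  rw [Int.floor_eq_iff] at hfl
  have hy1 : (-(2 : ℝ) ^ m) ≤ (y i : ℝ) := by exact_mod_cast (hy i).1
  have hy2 : (y i : ℝ) + 1 ≤ (2 : ℝ) ^ m := by
    have : y i + 1 ≤ (2 : ℤ) ^ m := (hy i).2
    exact_mod_cast this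
  constructor
  · by_contra hc; push Not at hc; nlinarith [hfl.1]
  · by_contra hc; push Not at hc; nlinarith [hfl.2]

/-! ## §2 Lattice ranges and the energy on the lattice cube -/

/-- On the half-open cube the floor-vector of `N·x` lies in the lattice cube `[−N, N−1]³`. [folklore] -/
theorem floorVec_mem_latticeCube {N : ℕ} (hN : 1 ≤ N) {x : EuclideanSpace ℝ (Fin 3)} (hx : ∀ i, -1 ≤ x i ∧ x i < 1) :
    (fun i => ⌊(N : ℝ) * x i⌋ : Zd 3) ∈ Fintype.piFinset fun _ : Fin 3 => Finset.Icc (-(N : ℤ)) ((N : ℤ) - 1) := by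
  rw [Fintype.mem_piFinset]
  intro i
  rw [Finset.mem_Icc]
  have hN0 : (0 : ℝ) < N := by exact_mod_cast hN
  constructor
  · apply Int.le_floor.2; push_cast; nlinarith [(hx i).1]
  · have : ⌊(N : ℝ) * x i⌋ < (N : ℤ) := by apply Int.floor_lt.2; push_cast; nlinarith [(hx i).2]
    omega

/-- The bond energy of `p ↦ u (z + p)` on the lattice cube `[−N, N−1]³` is at most the energy of `u` on `box z N`. [folklore] -/
theorem latticeCube_energy_le {F : Type*} [NormedAddCommGroup F] (u : Zd 3 → F) (z : Zd 3) (N : ℕ) :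
    ∑ p ∈ Fintype.piFinset (fun _ : Fin 3 => Finset.Icc (-(N : ℤ)) ((N : ℤ) - 1)), ∑ μ : Fin 3, ‖u (z + (p + unitVec μ)) - u (z + p)‖ ^ 2
      ≤ ∑ y ∈ box z N, ∑ μ : Fin 3, ‖u (y + unitVec μ) - u y‖ ^ 2 := by
  classical
  set A := Fintype.piFinset (fun _ : Fin 3 => Finset.Icc (-(N : ℤ)) ((N : ℤ) - 1)) with hA
  have hinj : ∀ p ∈ A, ∀ q ∈ A, (fun p : Zd 3 => z + p) p = (fun p : Zd 3 => z + p) q → p = q :=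
    fun p _ q _ h => add_left_cancel h
  have hre : ∑ p ∈ A, ∑ μ : Fin 3, ‖u (z + (p + unitVec μ)) - u (z + p)‖ ^ 2
      = ∑ y ∈ A.image (fun p : Zd 3 => z + p), ∑ μ : Fin 3, ‖u (y + unitVec μ) - u y‖ ^ 2 := by
    rw [Finset.sum_image hinj]
    refine Finset.sum_congr rfl fun p _ => Finset.sum_congr rfl fun μ _ => by rw [add_assoc]
  rw [hre]
  refine Finset.sum_le_sum_of_subset_of_nonneg (fun y hy => ?_) fun _ _ _ => Finset.sum_nonneg fun _ _ => sq_nonneg _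
  rw [Finset.mem_image] at hy
  obtain ⟨p, hp, rfl⟩ := hy
  rw [hA, Fintype.mem_piFinset] at hp
  rw [mem_box]
  intro i
  have := hp i
  rw [Finset.mem_Icc] at this
  rw [Pi.add_apply, add_sub_cancel_left, abs_le]
  constructor <;> omega

/-- The lattice cube `[−N, N−1]³` has `(2N)³` points. [folklore] -/
theorem card_latticeCube (N : ℕ) : (Fintype.piFinset (fun _ : Fin 3 => Finset.Icc (-(N : ℤ)) ((N : ℤ) - 1))).card = (2 * N) ^ 3 := by
  rw [Fintype.card_piFinset, Finset.prod_const, Finset.card_univ, Fintype.card_fin, Int.card_Icc]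
  congr 1
  omega

/-! ## §3 The gradient block means are bounded -/

/-- ★ **THE RESCALED DISCRETE GRADIENT HAS BOUNDED MEANS ON EVERY MEASURABLE SUBSET OF THE HALF-OPEN CUBE**: for a unit… (any) lattice map `u`, centre `z`, integer mesh
`N ≥ 1` with bond energy `≤ Λ₀·N` on `box z N`, and `D ⊆ [−1,1)³` measurable,
`‖∫_D N•(u(z + ⌊N x⌋ + e_μ) − u(z + ⌊N x⌋)) dx‖ ≤ √(8Λ₀)`. [folklore] [cite: AlicandroCicalese2008, §2] -/
theorem norm_setIntegral_gradBlowDown_le (u : Zd 3 → EuclideanSpace ℝ (Fin 4)) (z : Zd 3) (N : ℕ) (hN : 1 ≤ N) {Λ₀ : ℝ}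
    (hE : ∑ y ∈ box z N, ∑ μ : Fin 3, ‖u (y + unitVec μ) - u y‖ ^ 2 ≤ Λ₀ * N)
    {D : Set (EuclideanSpace ℝ (Fin 3))} (hD : MeasurableSet D) (hDQ : D ⊆ {x | ∀ i, -1 ≤ x i ∧ x i < 1}) (μ : Fin 3) :
    ‖∫ x in D, (N : ℝ) • (u ((z + fun i => ⌊(N : ℝ) * x i⌋) + unitVec μ) - u (z + fun i => ⌊(N : ℝ) * x i⌋))‖ ≤ Real.sqrt (8 * Λ₀) := by
  classical
  have hN0 : (0 : ℝ) < N := by exact_mod_cast hN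
  set A := Fintype.piFinset (fun _ : Fin 3 => Finset.Icc (-(N : ℤ)) ((N : ℤ) - 1)) with hA
  -- the lattice function whose blow-down is the integrand's norm
  set G : Zd 3 → ℝ := fun p => ‖(N : ℝ) • (u ((z + p) + unitVec μ) - u (z + p))‖ with hG
  have hG0 : ∀ p, 0 ≤ G p := fun p => norm_nonneg _
  have h1 : ‖∫ x in D, (N : ℝ) • (u ((z + fun i => ⌊(N : ℝ) * x i⌋) + unitVec μ) - u (z + fun i => ⌊(N : ℝ) * x i⌋))‖
      ≤ ∫ x in D, G (fun i => ⌊(N : ℝ) * x i⌋) := norm_integral_le_integral_norm _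
  have h2 : ∫ x in D, G (fun i => ⌊(N : ℝ) * x i⌋) ≤ (N : ℝ)⁻¹ ^ 3 * ∑ p ∈ A, G p :=
    setIntegral_comp_floorVec_le_sum hN0 hD A (fun x hx => floorVec_mem_latticeCube hN (hDQ hx)) G hG0
  -- the lattice sum: `Σ_A ‖N•δ‖ = N·Σ_A ‖δ‖ ≤ N·√(#A · Σ‖δ‖²) ≤ N·√(8N³·Λ₀N)`
  have hsumG : ∑ p ∈ A, G p = (N : ℝ) * ∑ p ∈ A, ‖u ((z + p) + unitVec μ) - u (z + p)‖ := by
    rw [Finset.mul_sum]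
    refine Finset.sum_congr rfl fun p _ => ?_
    simp only [hG, norm_smul, Real.norm_eq_abs, abs_of_nonneg hN0.le]
  have hEA : ∑ p ∈ A, ‖u ((z + p) + unitVec μ) - u (z + p)‖ ^ 2 ≤ Λ₀ * N := by
    calc ∑ p ∈ A, ‖u ((z + p) + unitVec μ) - u (z + p)‖ ^ 2
        ≤ ∑ p ∈ A, ∑ ν : Fin 3, ‖u (z + (p + unitVec ν)) - u (z + p)‖ ^ 2 :=
          Finset.sum_le_sum fun p _ => by
            have e : ∀ ν : Fin 3, z + (p + unitVec ν) = z + p + unitVec ν := fun ν => (add_assoc _ _ _).symm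
            simp only [e]
            exact Finset.single_le_sum (f := fun ν => ‖u (z + p + unitVec ν) - u (z + p)‖ ^ 2) (fun _ _ => sq_nonneg _) (Finset.mem_univ μ)
      _ ≤ _ := (latticeCube_energy_le u z N).trans hE
  have hCS : ∑ p ∈ A, ‖u ((z + p) + unitVec μ) - u (z + p)‖ ≤ Real.sqrt ((A.card : ℝ) * (Λ₀ * N)) := by
    apply Real.le_sqrt_of_sq_le
    exact sq_sum_le_card_mul_sum_sq.trans (mul_le_mul_of_nonneg_left hEA (Nat.cast_nonneg _))
  have hcard : (A.card : ℝ) = 8 * (N : ℝ) ^ 3 := by rw [hA, card_latticeCube]; push_cast; ring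
  rw [hcard] at hCS
  have hsq : Real.sqrt (8 * (N : ℝ) ^ 3 * (Λ₀ * N)) = (N : ℝ) ^ 2 * Real.sqrt (8 * Λ₀) := by
    rw [show 8 * (N : ℝ) ^ 3 * (Λ₀ * N) = ((N : ℝ) ^ 2) ^ 2 * (8 * Λ₀) by ring, Real.sqrt_mul (by positivity), Real.sqrt_sq (by positivity)]
  rw [hsq] at hCS
  calc ‖∫ x in D, (N : ℝ) • (u ((z + fun i => ⌊(N : ℝ) * x i⌋) + unitVec μ) - u (z + fun i => ⌊(N : ℝ) * x i⌋))‖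
      ≤ (N : ℝ)⁻¹ ^ 3 * ∑ p ∈ A, G p := h1.trans h2
    _ = (N : ℝ)⁻¹ ^ 3 * ((N : ℝ) * ∑ p ∈ A, ‖u ((z + p) + unitVec μ) - u (z + p)‖) := by rw [hsumG]
    _ ≤ (N : ℝ)⁻¹ ^ 3 * ((N : ℝ) * ((N : ℝ) ^ 2 * Real.sqrt (8 * Λ₀))) := by gcongr
    _ = Real.sqrt (8 * Λ₀) := by field_simp


/-! ## §4 The translation modulus of the zero-extended blow-down, `eLpNorm` form -/

/-- `|xᵢ| ≤ ‖x‖` on `EuclideanSpace`. [folklore] -/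
theorem abs_coord_le_norm (x : EuclideanSpace ℝ (Fin 3)) (i : Fin 3) : |x i| ≤ ‖x‖ := by
  have := PiLp.norm_apply_le x i
  rwa [Real.norm_eq_abs] at this

/-- ★★ **THE UNIFORM MODULUS, `eLpNorm` FORM** (✓M2b fed with ✓M2a and ✓M1, BY NAME): for the zero-extended blow-down `f = 𝟙_{[−1,1)³}·(x ↦ u(z + ⌊N x⌋))` of a unit lattice map with
bond energy `≤ Λ₀·N` on `box z N`, and `‖y‖ ≤ δ ≤ 1`: `eLpNorm (f(· − y) − f) 2 volume ≤ (ofReal ((288Λ₀ + 192)·δ))^{1∕2}` — uniform in `N`.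
[folklore] [cite: Adams1975, Thm 2.21] -/
theorem eLpNorm_translate_blowDown_sub_le (u : Zd 3 → EuclideanSpace ℝ (Fin 4)) (hu : ∀ p, ‖u p‖ = 1) (z : Zd 3) (N : ℕ) (hN : 1 ≤ N)
    {Λ₀ : ℝ} (hΛ₀ : 0 ≤ Λ₀) (hE : ∑ y ∈ box z N, ∑ μ : Fin 3, ‖u (y + unitVec μ) - u y‖ ^ 2 ≤ Λ₀ * N)
    (y : EuclideanSpace ℝ (Fin 3)) {δ : ℝ} (hδ1 : δ ≤ 1) (hy : ‖y‖ ≤ δ) :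
    eLpNorm (fun x : EuclideanSpace ℝ (Fin 3) =>
        Set.indicator {x' : EuclideanSpace ℝ (Fin 3) | ∀ i, -1 ≤ x' i ∧ x' i < 1} (fun x' => u (z + fun i => ⌊(N : ℝ) * x' i⌋)) (x - y)
        - Set.indicator {x' : EuclideanSpace ℝ (Fin 3) | ∀ i, -1 ≤ x' i ∧ x' i < 1} (fun x' => u (z + fun i => ⌊(N : ℝ) * x' i⌋)) x) 2 volume
      ≤ ENNReal.ofReal ((288 * Λ₀ + 192) * δ) ^ (1 / 2 : ℝ) := by
  classical
  have hN0 : (0 : ℝ) < N := by exact_mod_cast hN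
  have hδ0 : 0 ≤ δ := (norm_nonneg y).trans hy
  have ht : ∀ i, |y i| ≤ δ := fun i => (abs_coord_le_norm y i).trans hy
  set v : Zd 3 → EuclideanSpace ℝ (Fin 4) := fun p => u (z + p) with hv
  set f : EuclideanSpace ℝ (Fin 3) → EuclideanSpace ℝ (Fin 4) :=
    Set.indicator {x' : EuclideanSpace ℝ (Fin 3) | ∀ i, -1 ≤ x' i ∧ x' i < 1} (fun x' => u (z + fun i => ⌊(N : ℝ) * x' i⌋)) with hf
  -- the displayed rows of M2b, by name
  have hEA : ∑ p ∈ Fintype.piFinset (fun _ : Fin 3 => Finset.Icc (-(N : ℤ)) ((N : ℤ) - 1)), ∑ μ : Fin 3, ‖v (p + unitVec μ) - v p‖ ^ 2 ≤ Λ₀ * N :=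
    (latticeCube_energy_le u z N).trans hE
  have hM1 : ∀ w ∈ Fintype.piFinset (fun i : Fin 3 => ({⌊(N : ℝ) * y i⌋, ⌈(N : ℝ) * y i⌉} : Finset ℤ)),
      ∑ a ∈ Fintype.piFinset (fun i : Fin 3 => Finset.Icc (max (-(N : ℤ)) (-(N : ℤ) + w i)) (min ((N : ℤ) - 1) ((N : ℤ) - 1 + w i))),
        ‖v a - v (a - w)‖ ^ 2 ≤ 3 * (∑ j : Fin 3, ((w j : ℤ) : ℝ) ^ 2) * (Λ₀ * N) := by
    intro w _
    refine (sum_norm_sub_translate_sq_le v (-(N : ℤ)) ((N : ℤ) - 1) w).trans ?_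
    exact mul_le_mul_of_nonneg_left hEA (by positivity)
  have hlin := lintegral_translate_sub_sq_le v (fun p => (hu (z + p)).le) N hN f
    (fun x hx => by
      rw [hf]
      exact Set.indicator_of_mem (show x ∈ {x' : EuclideanSpace ℝ (Fin 3) | ∀ i, -1 ≤ x' i ∧ x' i < 1} from hx) _)
    (fun x hx => by
      rw [hf]
      exact Set.indicator_of_notMem (show x ∉ {x' : EuclideanSpace ℝ (Fin 3) | ∀ i, -1 ≤ x' i ∧ x' i < 1} from hx) _)
    (by positivity : 0 ≤ Λ₀ * N) y ht hδ1
    (Fintype.piFinset fun i : Fin 3 => ({⌊(N : ℝ) * y i⌋, ⌈(N : ℝ) * y i⌉} : Finset ℤ)) (card_shifts_le (N : ℝ) y)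
    (fun x => floorVec_sub_mem_shifts (N : ℝ) x y) (fun w hw i => abs_le_of_mem_shifts hN0.le y hw i)
    (fun w i => max 0 (((N : ℝ))⁻¹ - |y i - (w i : ℝ) / N|)) (fun w i => cellLength_nonneg _ _ _) (fun w i => cellLength_le_inv hN0 _ _)
    (fun w i => cellLength_mul_abs_le hN0 (y i) (w i)) (fun a w => measurableSet_twoGridCell hN0 y a w)
    (fun a w => volume_twoGridCell_le hN0 y a w) hM1
  -- simplify the bound
  have hdiv : Λ₀ * N / N = Λ₀ := by field_simp
  rw [hdiv] at hlin
  have hb : 144 * Λ₀ * (δ ^ 2 + δ) + 192 * δ ≤ (288 * Λ₀ + 192) * δ := by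
    have : δ ^ 2 ≤ δ := by nlinarith
    nlinarith
  have hlin' : ∫⁻ x, ‖f (x - y) - f x‖ₑ ^ (2 : ℝ) ≤ ENNReal.ofReal ((288 * Λ₀ + 192) * δ) := by
    simp only [ENNReal.rpow_two]
    exact hlin.trans (ENNReal.ofReal_le_ofReal hb)
  rw [eLpNorm_eq_lintegral_rpow_enorm_toReal two_ne_zero ENNReal.ofNat_ne_top, ENNReal.toReal_ofNat]
  exact ENNReal.rpow_le_rpow hlin' (by norm_num)


end Summit.QuantumFields.YangMills.Theorems.PoincareLipschitzBlowDownModulus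

end
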